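import Summits.ABC.IUTFork.Cor312Ind3RealIterates
import Summits.ABC.IUTFork.Thm311RealLog
import Literature.IUT.LogVolume.UnitLogIntoMaximalIdeal
import Literature.IUT.LogVolume.RescaledCompletionInvariants
import Literature.IUT.LogVolume.AdicCompletionLogShell
import HarnessLib

/-!
# [IUTchIII] Thm 3.11 (ii) (Ind3), honest model: the depth-`≥ 2` nonarchimedean iterate clauses are VACUOUS
# at every place of small ramification (abc-iut cell, wave-5 seat abc-iut-w5-d172; record-only, D-0012)

S. Mochizuki, *Inter-universal Teichmüller theory III*, kurims manuscript (May 2020), Prop. 3.5 (ii) (a)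
p. 104 and Thm. 3.11 (ii) (Ind3) p. 156 [claim: Mochizuki2012, status: disputed]: the integral structures
contain the images of the units "via … (2) the tensor product … of the pre-composite of these Kummer
isomorphisms with the `m′`-th iterates [cf. Remark 1.1.1] of the log-links, for `m′ ≥ 1`".

abc-iut-w4-d029's `Cor312Ind3RealIterates` (p412330) models these iterates HONESTLY at a finite place `v`:
`Real.nonarchIterImage logv v (m′+1)` = `log_v` applied to the units lying in the `m′`-th image (Rmk. 1.1.1:
the iterate is defined exactly on those), for the free family `logv : PadicLogs F`, and proves the (Ind3)
containments for every `logv`.  Two second-pass audits of that discharge (abc-iut-w5-d060 O-d060-4,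
abc-iut-w5-d064 N1, STATUS 2026-08-25T23:55/23:56Z) observed IN PROSE that at the intended inhabitant
`logv := Real.analyticLogv F` (abc-iut-c312-5's analytic `p_v`-adic logarithms, `Thm311RealLog`) the
depth-`≥ 2` images are EMPTY wherever `log_v(O_v^×) ⊆ 𝔪_v` — so that the corresponding (Ind3) containments
carry no content there.  This PROOF-ONLY file makes that observation KERNEL-VISIBLE:

* `Real.norm_of_analyticLogv_lt_one` — at a finite place `v` with `e(v|p_v) ≤ p_v − 1` the analytic
  logarithm of every unit has rescaled norm `< 1` (classical: `Literature.IUT.LogVolume.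
  norm_unitLog_lt_one_of_absRamificationIdx_le`, Koblitz GTM 58 Ch. IV §1, with
  `e(F_v) = e(v|p)` = `absRamificationIdx_rescaledCompletion`); hence `Real.analyticLogv_ne_coe_unit`:
  it is never (the image of) a unit of `O_v`;
* **`Real.nonarchIterImage_add_two_eq_empty`**, **`Real.iterImage_add_two_inr_eq_empty`** — for such `v`
  and every `m′ ≥ 2`, the honest iterate image of units is `∅` (`…_eq_empty_of_two_le`); in particular at
  every UNRAMIFIED finite place (`…_of_unramified`) and at every `v` with `p_v > [F : ℚ]`
  (`…_of_finrank_lt`, via `e(v|p) ≤ [F : ℚ]` = Mathlib `Ideal.ramificationIdx_le_finrank`) — all but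
  finitely many `v`;
* `Real.honestU_inr_add_two_eq_empty`, `LogShells.tprodImages_eq_empty_of_eq_empty`,
  **`Real.tprodImages_honestU_add_two_eq_empty`**, **`Column.unitImage_add_two_eq_empty_of_honestImages`** —
  consequently, for ANY column over `Real.logShellsDH X (analyticLogv F)` whose unit images are the
  pure-tensor images of the honest components (the hypothesis `hunit` of abc-iut-w4-d029's
  `Column.ind3_logShellsDH_of_honestImages`), the unit image at `(m, m′, j, v_ℚ)` is EMPTY whenever
  `m′ ≥ 2` and some place of `F` over `v_ℚ` has `e ≤ p − 1`: the (Ind3) containment there is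
  `Set.empty_subset _` — kernel-certified VACUITY of those clauses in the honest model;
* `Real.archIterImage_add_three_eq_empty`, **`Column.unitImage_add_three_arch_eq_empty_of_honestImages`** —
  at ARCHIMEDEAN `v_ℚ` the honest iterate images (principal complex logarithm on norm-one elements) are EMPTY
  from depth `3` on, for EVERY `logv` (depth-`2` elements have norm `π/2 ≠ 1`), so those unit-image clauses
  are vacuous too;
* non-vacuity at depths `0, 1` for contrast: `Real.one_mem_unitsSet_inr`, `Real.zero_mem_nonarchIterImage_one`,
  `Real.nonarchIterImage_one_eq_range` (the depth-`1` image is the whole `log_v(O_v^×)`).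

Honest framing: a statement ABOUT THE MODEL (which typed containments are trivially true), neither a defect
of p412330 nor a claim about [IUTchIII]; nothing here asserts or denies Cor. 3.12 or takes a side;
typed ≠ proved; instantiated ≠ endorsed.  No definitions; no new Prop-valued fact (D-0067 (1)).
-/

noncomputable section

open Set

namespace Summit.ABC.IUTFork.Thm311

/-! ## 0. A pure-tensor image with an empty component is empty -/

namespace LogShells

variable {T : ThetaIndex} (L : LogShells T)

/-- If one per-place component set `S_v` is empty, the pure-tensor image `tprodImages j v_ℚ S` is empty
(the index set `S^±_{j+1} = {0, …, j}` of tensor factors is nonempty, so a pure tensor has a component at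
`v`). [folklore] -/
theorem tprodImages_eq_empty_of_eq_empty (j : T.Label) (vQ : T.VQ)
    (S : ∀ v : T.Fibre vQ, Set (L.carrier v.1)) (v : T.Fibre vQ) (hS : S v = ∅) :
    L.tprodImages j vQ S = ∅ := by
  ext t
  simp only [mem_empty_iff_false, iff_false]
  rintro ⟨x, hx, -⟩
  have h := hx ⟨0, Nat.succ_pos _⟩ v
  rw [hS] at h
  exact h

end LogShells

namespace Real

open NumberField IsDedekindDomain Literature.IUT.LogVolume Literature.IUT.LogThetaLattice
  Literature.NumberTheory.NumberFields

variable {F : Type} [Field F] [NumberField F]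

/-! ## 1. Depths `0` and `1`: the honest images are inhabited (for contrast) -/

/-- `1 ∈ O_v^×`: the honest unit set at a finite place is inhabited. [folklore] -/
theorem one_mem_unitsSet_inr (v : HeightOneSpectrum (𝓞 F)) :
    (1 : Carrier (.inr v : Place F)) ∈ unitsSet (.inr v : Place F) :=
  ⟨one_ne_zero, one_mem _, by rw [inv_one]; exact one_mem _⟩

/-- A unit of `O_v`, viewed in `K_v`, lies in the honest unit set `unitsSet` (local copy of abc-iut-w4-d087's
`Real.coe_unit_mem_unitsSet` of `Thm311PartIIDischargeReal`, which cannot be co-imported with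
`Cor312Ind3RealIterates` — both declare `Real.iterImage`, finding F-w5d064-1). [folklore] -/
private theorem coe_unit_mem_unitsSet_aux (v : HeightOneSpectrum (𝓞 F)) (u : (↥(integers v))ˣ) :
    ((u : ↥(integers v)) : Carrier (.inr v : Place F)) ∈ unitsSet (.inr v : Place F) := by
  have hmul : ((u : ↥(integers v)) : Carrier (.inr v : Place F)) *
      ((↑(u⁻¹) : ↥(integers v)) : Carrier (.inr v : Place F)) = 1 := by
    rw [← MulMemClass.coe_mul, Units.mul_inv, OneMemClass.coe_one]
  have hne : ((u : ↥(integers v)) : Carrier (.inr v : Place F)) ≠ 0 := fun h => by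
    rw [h, zero_mul] at hmul
    exact zero_ne_one hmul
  refine ⟨hne, (u : ↥(integers v)).2, ?_⟩
  rw [← eq_inv_of_mul_eq_one_right hmul]
  · exact (↑(u⁻¹) : ↥(integers v)).2

/-- `0 = log_v(1)` lies in the depth-`1` honest image, for every family `logv`: the depth-`1` (Ind3) clause
is NOT vacuous. [claim: Mochizuki2012, status: disputed] -/
theorem zero_mem_nonarchIterImage_one (logv : PadicLogs F) (v : HeightOneSpectrum (𝓞 F)) :
    (0 : Carrier (.inr v : Place F)) ∈ nonarchIterImage logv v 1 := by
  refine ⟨1, ?_, ?_⟩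
  · show (((1 : (↥(integers v))ˣ) : ↥(integers v)) : Carrier (.inr v : Place F)) ∈ nonarchIterImage logv v 0
    rw [nonarchIterImage_zero, Units.val_one, OneMemClass.coe_one]
    exact one_mem_unitsSet_inr v
  · show logv v (Additive.ofMul 1) = 0
    rw [ofMul_one, map_zero]

/-- The depth-`1` honest image is the whole of `log_v(O_v^×)` (every unit of `O_v` lies in `unitsSet`).
[claim: Mochizuki2012, status: disputed] -/
theorem nonarchIterImage_one_eq_range (logv : PadicLogs F) (v : HeightOneSpectrum (𝓞 F)) :
    nonarchIterImage logv v 1 = range (fun u : (↥(integers v))ˣ => logv v (Additive.ofMul u)) := by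
  ext z
  constructor
  · rintro ⟨u, -, rfl⟩
    exact ⟨u, rfl⟩
  · rintro ⟨u, rfl⟩
    exact ⟨u, coe_unit_mem_unitsSet_aux v u, rfl⟩

/-- Every honest iterate image of depth `≥ 1` lies in `log_v(O_v^×)`. [claim: Mochizuki2012, status: disputed] -/
theorem nonarchIterImage_succ_subset_range (logv : PadicLogs F) (v : HeightOneSpectrum (𝓞 F)) (k : ℕ) :
    nonarchIterImage logv v (k + 1) ⊆ range (fun u : (↥(integers v))ˣ => logv v (Additive.ofMul u)) := by
  rintro _ ⟨u, -, rfl⟩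
  exact ⟨u, rfl⟩

/-! ## 2. The analytic logarithm of a unit is never a unit (small ramification) -/

/-- **At a finite place `v` with `e(v|p_v) ≤ p_v − 1`, `‖log_v(w)‖' < 1` for every unit `w ∈ O_v^×`** — the
analytic logarithm (abc-iut-c312-5's `analyticLogv`, = abc-iut-S1's `unitLog` in abc-iut-S7's rescaled
completion) takes units into the maximal ideal (`Literature.IUT.LogVolume.
norm_unitLog_lt_one_of_absRamificationIdx_le`, with `e(F_v) = e(v|p)`). [cite: Koblitz1984, Ch. IV §1] -/
theorem norm_of_analyticLogv_lt_one (v : HeightOneSpectrum (𝓞 F))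
    (he : v.asIdeal.ramificationIdx ℤ ≤ residueChar F v - 1) (w : (↥(integers v))ˣ) :
    ‖RescaledCompletion.of F (residueChar F v) v (natCast_residueChar_mem F v)
        (analyticLogv F v (Additive.ofMul w))‖ < 1 := by
  haveI : Fact (residueChar F v).Prime := ⟨residueChar_prime F v⟩
  rw [analyticLogv_apply, RingEquiv.apply_symm_apply]
  refine norm_unitLog_lt_one_of_absRamificationIdx_le (residueChar F v) ?_ _
  rw [absRamificationIdx_rescaledCompletion]
  exact he

/-- **Hence the analytic logarithm of a unit is never a unit of `O_v`** (units have rescaled norm `1`,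
`norm_of_coe_unit_adicCompletionIntegers`). [cite: Koblitz1984, Ch. IV §1] -/
theorem analyticLogv_ne_coe_unit (v : HeightOneSpectrum (𝓞 F))
    (he : v.asIdeal.ramificationIdx ℤ ≤ residueChar F v - 1) (w u : (↥(integers v))ˣ) :
    analyticLogv F v (Additive.ofMul w) ≠ ((u : ↥(integers v)) : Carrier (.inr v : Place F)) := by
  intro h
  have h1 := norm_of_analyticLogv_lt_one v he w
  rw [h] at h1
  have h2 := norm_of_coe_unit_adicCompletionIntegers F (residueChar F v) v (natCast_residueChar_mem F v) u
  exact h1.ne h2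

/-! ## 3. The depth-`≥ 2` honest iterate images are EMPTY -/

/-- **At a finite place with `e(v|p_v) ≤ p_v − 1`, the honest iterate image of depth `m′ + 2` is empty**:
no unit lies in the depth-`(m′+1)` image `⊆ log_v(O_v^×) ⊆ 𝔪_v`, so the next iterate of the log-link on
units has empty domain ([IUTchIII] Rmk. 1.1.1 (i)). [claim: Mochizuki2012, status: disputed] -/
theorem nonarchIterImage_add_two_eq_empty (v : HeightOneSpectrum (𝓞 F))
    (he : v.asIdeal.ramificationIdx ℤ ≤ residueChar F v - 1) (k : ℕ) :
    nonarchIterImage (analyticLogv F) v (k + 2) = ∅ := by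
  ext z
  simp only [mem_empty_iff_false, iff_false]
  rintro ⟨u, hu, -⟩
  obtain ⟨w, hw⟩ := nonarchIterImage_succ_subset_range (analyticLogv F) v k hu
  exact analyticLogv_ne_coe_unit v he w u hw

/-- The same for every depth `m′ ≥ 2`. [claim: Mochizuki2012, status: disputed] -/
theorem nonarchIterImage_eq_empty_of_two_le (v : HeightOneSpectrum (𝓞 F))
    (he : v.asIdeal.ramificationIdx ℤ ≤ residueChar F v - 1) {m' : ℕ} (hm' : 2 ≤ m') :
    nonarchIterImage (analyticLogv F) v m' = ∅ := by
  obtain ⟨k, rfl⟩ := Nat.exists_eq_add_of_le' hm'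
  exact nonarchIterImage_add_two_eq_empty v he k

/-- **The honest per-place family at depth `≥ 2` is empty at such a finite place.**
[claim: Mochizuki2012, status: disputed] -/
theorem iterImage_add_two_inr_eq_empty (v : HeightOneSpectrum (𝓞 F))
    (he : v.asIdeal.ramificationIdx ℤ ≤ residueChar F v - 1) (k : ℕ) :
    iterImage (analyticLogv F) (k + 2) (.inr v : Place F) = ∅ :=
  nonarchIterImage_add_two_eq_empty v he k

/-- **Unramified places** (`e(v|p_v) = 1`, all but finitely many `v`; every `p_v`, `2` included): the honest
iterate images of depth `≥ 2` are empty. [claim: Mochizuki2012, status: disputed] -/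
theorem nonarchIterImage_add_two_eq_empty_of_unramified (v : HeightOneSpectrum (𝓞 F))
    (he : v.asIdeal.ramificationIdx ℤ = 1) (k : ℕ) :
    nonarchIterImage (analyticLogv F) v (k + 2) = ∅ :=
  nonarchIterImage_add_two_eq_empty v
    (by rw [he]; exact Nat.le_sub_one_of_lt (residueChar_prime F v).one_lt) k

/-! ## 3b. Large residue characteristic: `p_v > [F : ℚ]` forces `e(v|p_v) ≤ p_v − 1` -/

/-- `e(v|p_v) ≤ [F : ℚ]` for every finite place `v` of the number field `F` (Mathlib's
`Ideal.ramificationIdx_le_finrank`, from the fundamental identity `Σ e_i f_i = [F : ℚ]`; proof adapted from the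
tree's `ramificationIdx_le_finrank_rat`). [folklore] -/
theorem ramificationIdx_le_finrank (v : HeightOneSpectrum (𝓞 F)) :
    v.asIdeal.ramificationIdx ℤ ≤ Module.finrank ℚ F := by
  have hmem : ((residueChar F v : ℕ) : ℤ) ∈ v.asIdeal.under ℤ := by
    rw [Ideal.under_def, Ideal.mem_comap, map_natCast]
    exact natCast_residueChar_mem F v
  have hne : v.asIdeal.under ℤ ≠ ⊥ := by
    intro h
    rw [h, Ideal.mem_bot, Nat.cast_eq_zero] at hmem
    exact (residueChar_prime F v).ne_zero hmem
  haveI : v.asIdeal.IsMaximal := v.isMaximal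
  haveI : (v.asIdeal.under ℤ).IsMaximal := Ideal.IsMaximal.under ℤ v.asIdeal
  rw [← Ideal.ramificationIdx'_eq_ramificationIdx (v.asIdeal.under ℤ) v.asIdeal hne]
  exact Ideal.ramificationIdx_le_finrank (R := ℤ) (S := 𝓞 F) ℚ F v.asIdeal

/-- Hence at a finite place whose residue characteristic exceeds the degree, `p_v > [F : ℚ]` (all but
finitely many primes `p_v`), the ramification is small: `e(v|p_v) ≤ p_v − 1`. [folklore] -/
theorem ramificationIdx_le_residueChar_sub_one_of_finrank_lt (v : HeightOneSpectrum (𝓞 F))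
    (h : Module.finrank ℚ F < residueChar F v) : v.asIdeal.ramificationIdx ℤ ≤ residueChar F v - 1 :=
  (ramificationIdx_le_finrank v).trans (Nat.le_sub_one_of_lt h)

/-- **Large primes**: at every finite place `v` with `p_v > [F : ℚ]` the honest iterate images of depth `≥ 2`
are empty — so for all but finitely many `v_ℚ ∈ V^non_ℚ` the depth-`≥ 2` (Ind3) clauses of the honest model
are vacuous at EVERY place of the fibre. [claim: Mochizuki2012, status: disputed] -/
theorem nonarchIterImage_add_two_eq_empty_of_finrank_lt (v : HeightOneSpectrum (𝓞 F))
    (h : Module.finrank ℚ F < residueChar F v) (k : ℕ) :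
    nonarchIterImage (analyticLogv F) v (k + 2) = ∅ :=
  nonarchIterImage_add_two_eq_empty v (ramificationIdx_le_residueChar_sub_one_of_finrank_lt v h) k

/-! ## 4. Consequence for the honest column: the (Ind3) unit-image clauses at depth `≥ 2` are vacuous -/

/-- The honest component family `honestU` of abc-iut-w4-d029 at depth `m′ + 2` is empty at a finite place of
the fibre with `e ≤ p − 1`. [claim: Mochizuki2012, status: disputed] -/
theorem honestU_inr_add_two_eq_empty (X : PilotData F) (m : ℤ) (k : ℕ) {vQ : (thetaIndex X).VQ}
    (w : HeightOneSpectrum (𝓞 F)) (hw : (thetaIndex X).over (.inr w) = vQ)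
    (he : w.asIdeal.ramificationIdx ℤ ≤ residueChar F w - 1) :
    honestU X (analyticLogv F) m (k + 2) vQ ⟨.inr w, hw⟩ = ∅ :=
  nonarchIterImage_add_two_eq_empty w he k

/-- **The pure-tensor unit image of the honest components at depth `m′ + 2` is EMPTY** at every `v_ℚ` over
which some place `w` of `F` has `e(w|p) ≤ p − 1`. [claim: Mochizuki2012, status: disputed] -/
theorem tprodImages_honestU_add_two_eq_empty (X : PilotData F) (m : ℤ) (k : ℕ)
    (j : (thetaIndex X).Label) {vQ : (thetaIndex X).VQ}
    (w : HeightOneSpectrum (𝓞 F)) (hw : (thetaIndex X).over (.inr w) = vQ)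
    (he : w.asIdeal.ramificationIdx ℤ ≤ residueChar F w - 1) :
    (logShellsDH X (analyticLogv F)).tprodImages j vQ (honestU X (analyticLogv F) m (k + 2) vQ) = ∅ :=
  LogShells.tprodImages_eq_empty_of_eq_empty _ j vQ _ ⟨.inr w, hw⟩
    (honestU_inr_add_two_eq_empty X m k w hw he)

/-- **Vacuity of the depth-`≥ 2` (Ind3) unit-image clauses in the honest model.** For ANY column over the
Dupuy–Hilado instance `Real.logShellsDH X (analyticLogv F)` whose unit images are the pure-tensor images of
the honest components (hypothesis `hunit` of abc-iut-w4-d029's `Column.ind3_logShellsDH_of_honestImages`):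
at every `(m, m′ + 2, j, v_ℚ)` with a place `w | v_ℚ` of `F` of ramification `e(w|p) ≤ p − 1`, the unit
image is `∅` — so the (Ind3) containment `unitImage ⊆ shellPk` there holds as `∅ ⊆ _`.
[claim: Mochizuki2012, status: disputed] -/
theorem _root_.Summit.ABC.IUTFork.Thm311.Column.unitImage_add_two_eq_empty_of_honestImages
    (X : PilotData F) (C : Column (logShellsDH X (analyticLogv F)))
    (hunit : ∀ (m : ℤ) (m' : ℕ) (j : (thetaIndex X).Label) (vQ : (thetaIndex X).VQ),
      C.unitImage m m' j vQ =
        (logShellsDH X (analyticLogv F)).tprodImages j vQ (honestU X (analyticLogv F) m m' vQ))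
    (m : ℤ) (k : ℕ) (j : (thetaIndex X).Label) {vQ : (thetaIndex X).VQ}
    (w : HeightOneSpectrum (𝓞 F)) (hw : (thetaIndex X).over (.inr w) = vQ)
    (he : w.asIdeal.ramificationIdx ℤ ≤ residueChar F w - 1) :
    C.unitImage m (k + 2) j vQ = ∅ := by
  rw [hunit]
  exact tprodImages_honestU_add_two_eq_empty X m k j w hw he

/-- **Large primes, packet level**: for a prime `v_ℚ = p_w > [F : ℚ]` under a place `w`, the honest unit
images of depth `≥ 2` at `v_ℚ` are empty. [claim: Mochizuki2012, status: disputed] -/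
theorem tprodImages_honestU_add_two_eq_empty_of_finrank_lt (X : PilotData F) (m : ℤ) (k : ℕ)
    (w : HeightOneSpectrum (𝓞 F)) (hw : Module.finrank ℚ F < residueChar F w)
    (j : (thetaIndex X).Label) :
    (logShellsDH X (analyticLogv F)).tprodImages j ((thetaIndex X).over (.inr w))
      (honestU X (analyticLogv F) m (k + 2) ((thetaIndex X).over (.inr w))) = ∅ :=
  tprodImages_honestU_add_two_eq_empty X m k j w rfl
    (ramificationIdx_le_residueChar_sub_one_of_finrank_lt w hw)

/-! ## 5. Archimedean places: the honest iterate images of depth `≥ 3` are EMPTY (every `logv`)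

At an archimedean place the honest iterate of abc-iut-w4-d029 is the principal complex logarithm on the
norm-one elements (read through Mathlib's isometric embedding `K_w → ℂ`): a depth-`≥ 1` element embeds to
`log z = i·arg z` (`‖z‖ = 1`), so a depth-`≥ 1` element OF NORM ONE embeds to `± i`, whose logarithm
`± iπ/2` has norm `π/2 ≠ 1` — hence depth `2` consists of elements of norm `π/2` and depth `≥ 3` is empty.
(Elementary; [IUTchIII] Rmk. 1.2.2 (ii) only asks for the images inside the radius-`π` ball.) -/

/-- A depth-`≥ 1` archimedean iterate element embeds to a complex number with real part `0`
(`Re log z = log ‖z‖ = 0`). [folklore] -/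
theorem re_extensionEmbedding_eq_zero_of_mem_archIterImage_succ (w : InfinitePlace F) (k : ℕ)
    {a : Carrier (.inl w : Place F)} (ha : a ∈ archIterImage w (k + 1)) :
    (InfinitePlace.Completion.extensionEmbedding w a).re = 0 := by
  obtain ⟨b, -, hb, hab⟩ := ha
  have hb' : ‖InfinitePlace.Completion.extensionEmbedding w b‖ = 1 := by
    rw [(InfinitePlace.Completion.isometry_extensionEmbedding w).norm_map_of_map_zero (map_zero _) b]
    exact hb
  rw [hab, Complex.log_re, hb', Real.log_one]

/-- A complex number of norm `1` with real part `0` is `± i`. [folklore] -/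
theorem _root_.Complex.eq_I_or_eq_neg_I_of_re_eq_zero_of_norm_eq_one {z : ℂ} (hre : z.re = 0)
    (hz : ‖z‖ = 1) : z = Complex.I ∨ z = -Complex.I := by
  have hzI : z = (z.im : ℂ) * Complex.I := Complex.ext (by simp [hre]) (by simp)
  have him : |z.im| = 1 := by
    rw [hzI, norm_mul, Complex.norm_I, mul_one, Complex.norm_real, Real.norm_eq_abs] at hz
    exact hz
  rcases (abs_eq zero_le_one).mp him with h | h
  · left
    rw [hzI, h, Complex.ofReal_one, one_mul]
  · right
    rw [hzI, h, Complex.ofReal_neg, Complex.ofReal_one, neg_mul, one_mul]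

/-- **Depth-`2` archimedean iterate elements have norm `π/2`** (`log(± i) = ± iπ/2`). [folklore] -/
theorem norm_eq_pi_div_two_of_mem_archIterImage_add_two (w : InfinitePlace F) (k : ℕ)
    {a : Carrier (.inl w : Place F)} (ha : a ∈ archIterImage w (k + 2)) : ‖a‖ = Real.pi / 2 := by
  obtain ⟨b, hb1, hb, hab⟩ := ha
  have hre := re_extensionEmbedding_eq_zero_of_mem_archIterImage_succ w k hb1
  have hnorm : ‖InfinitePlace.Completion.extensionEmbedding w b‖ = 1 := by
    rw [(InfinitePlace.Completion.isometry_extensionEmbedding w).norm_map_of_map_zero (map_zero _) b]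
    exact hb
  have hpi : ‖(Real.pi : ℂ) / 2 * Complex.I‖ = Real.pi / 2 := by
    have e : (Real.pi : ℂ) / 2 * Complex.I = ((Real.pi / 2 : ℝ) : ℂ) * Complex.I := by
      push_cast; ring
    rw [e, norm_mul, Complex.norm_I, mul_one, Complex.norm_real, Real.norm_eq_abs,
      abs_of_pos (half_pos Real.pi_pos)]
  have key : ‖InfinitePlace.Completion.extensionEmbedding w a‖ = Real.pi / 2 := by
    rw [hab]
    rcases Complex.eq_I_or_eq_neg_I_of_re_eq_zero_of_norm_eq_one hre hnorm with h | h
    · rw [h, Complex.log_I, hpi]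
    · rw [h, Complex.log_neg_I, neg_mul, norm_neg, hpi]
  rwa [(InfinitePlace.Completion.isometry_extensionEmbedding w).norm_map_of_map_zero (map_zero _) a] at key

/-- **At every archimedean place, the honest iterate images of depth `≥ 3` are EMPTY** (for every `logv`):
the next iterate needs a depth-`2` element of norm `1`, but these have norm `π/2`. [claim: Mochizuki2012, status: disputed] -/
theorem archIterImage_add_three_eq_empty (w : InfinitePlace F) (k : ℕ) : archIterImage w (k + 3) = ∅ := by
  ext a
  simp only [mem_empty_iff_false, iff_false]
  rintro ⟨b, hb2, hb, -⟩
  have h := norm_eq_pi_div_two_of_mem_archIterImage_add_two w k hb2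
  rw [hb] at h
  have := Real.pi_gt_three
  linarith

/-- The same for every depth `m′ ≥ 3`. [claim: Mochizuki2012, status: disputed] -/
theorem archIterImage_eq_empty_of_three_le (w : InfinitePlace F) {m' : ℕ} (hm' : 3 ≤ m') :
    archIterImage w m' = ∅ := by
  obtain ⟨k, rfl⟩ := Nat.exists_eq_add_of_le' hm'
  exact archIterImage_add_three_eq_empty w k

/-- The honest per-place family at depth `≥ 3` is empty at every archimedean place, for every `logv`.
[claim: Mochizuki2012, status: disputed] -/
theorem iterImage_add_three_inl_eq_empty (logv : PadicLogs F) (w : InfinitePlace F) (k : ℕ) :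
    iterImage logv (k + 3) (.inl w : Place F) = ∅ :=
  archIterImage_add_three_eq_empty w k

/-- The honest components `honestU` at depth `≥ 3` vanish on the whole fibre over `∞`.
[claim: Mochizuki2012, status: disputed] -/
theorem honestU_add_three_eq_empty_of_over_eq_inl (X : PilotData F) (logv : PadicLogs F) (m : ℤ) (k : ℕ)
    (u : Unit) (v : (thetaIndex X).Fibre (Sum.inl u : RatPlace)) : honestU X logv m (k + 3) (Sum.inl u) v = ∅ := by
  obtain ⟨x, hx⟩ := v
  cases x with
  | inl w => exact archIterImage_add_three_eq_empty w k
  | inr y => exact absurd hx (by simp [thetaIndex])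

/-- **The pure-tensor unit images of the honest components at the archimedean `v_ℚ = ∞` are EMPTY at every
depth `≥ 3`**, for every family `logv`. [claim: Mochizuki2012, status: disputed] -/
theorem tprodImages_honestU_add_three_arch_eq_empty (X : PilotData F) (logv : PadicLogs F) (m : ℤ) (k : ℕ)
    (j : (thetaIndex X).Label) (u : Unit) :
    (logShellsDH X logv).tprodImages j (Sum.inl u) (honestU X logv m (k + 3) (Sum.inl u)) = ∅ := by
  obtain ⟨v⟩ := (inferInstance : Nonempty ((thetaIndex X).Fibre (Sum.inl u : RatPlace)))
  exact LogShells.tprodImages_eq_empty_of_eq_empty _ j _ _ v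
    (honestU_add_three_eq_empty_of_over_eq_inl X logv m k u v)

/-- **Vacuity of the depth-`≥ 3` (Ind3) unit-image clauses at `v_ℚ = ∞` in the honest model**, for ANY
column with abc-iut-w4-d029's `hunit` and ANY family `logv`. [claim: Mochizuki2012, status: disputed] -/
theorem _root_.Summit.ABC.IUTFork.Thm311.Column.unitImage_add_three_arch_eq_empty_of_honestImages
    (X : PilotData F) (logv : PadicLogs F) (C : Column (logShellsDH X logv))
    (hunit : ∀ (m : ℤ) (m' : ℕ) (j : (thetaIndex X).Label) (vQ : (thetaIndex X).VQ),
      C.unitImage m m' j vQ = (logShellsDH X logv).tprodImages j vQ (honestU X logv m m' vQ))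
    (m : ℤ) (k : ℕ) (j : (thetaIndex X).Label) (u : Unit) :
    C.unitImage m (k + 3) j (Sum.inl u) = ∅ := by
  rw [hunit]
  exact tprodImages_honestU_add_three_arch_eq_empty X logv m k j u

end Real

end Summit.ABC.IUTFork.Thm311

end
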